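import Literature.AlgebraicGeometry.ModuliOfAbelianVarieties.SiegelAdelicCongrTransport
import Literature.AlgebraicGeometry.ModuliOfAbelianVarieties.SiegelPrincipalLevelNormal
import HarnessLib

/-!
# Transport of the adelic congruence `b·v̂ ≡ b′·ŵ` along a pair of endomorphisms intertwined by an integral adelic matrix:
# the `hℓ` clause of the E6-γ kernel from the FRAME LAW of the `𝒪`-action reading

Topic `Literature/AlgebraicGeometry/ModuliOfAbelianVarieties`; namespace `Literature.AlgebraicGeometry.ModuliOfAbelianVarieties`
(that of ★ `AdelicCongr`, ★ `SiegelAdelicCongrTransport`).  THEOREMS ONLY (no definition, no named fact, no instance, no `sorry`);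
CM-free, scheme-free matrix algebra over `𝔸_{ℚ,f}`.  Cell `hodgecm-mathlib` (D-0151), FLOOR 0, P6 door (E) of `stub_RGD`, E6 step 8,
organ **(K-c) of the Σ-GAL lineage** (LEAD F0P6-plan (g3) 2026-09-02 01:36:19Z; skeleton pen A-p04 (g24)): the hypothesis `hℓ` of ★
`SiegelAdelicMarking.conjugate_comp_conjFibreIso_eq_of_lifts_of_hom` (`SiegelConjFibreIsoEqCMIso`) —
«the pair `(ℓ, ℓ′)` of rational matrices preserves the congruence `(k r₁⁻¹) v̂ ≡ r₂⁻¹ ŵ (mod ℤ̂^{2g})`» — holds as soon as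
`ℓ′_𝔸 · (r₂ k r₁⁻¹) = (r₂ k r₁⁻¹) · ℓ_𝔸` with `ℓ′` integral and `r₂ ∈ K_δ(1)` (§2), in particular when `ℓ = q₁⁻¹ ρ q₁`, `ℓ′ = q₂⁻¹ ρ q₂`
are two MOVER-CONJUGATES of one rational frame reading `ρ` (the (M-fr)∕(N) clause of ★ `UnitaryCurve.AuxV.exists_chartActionReading`:
`Mρ a = (q a)⁻¹ ρ (q a)`) and the re-indexing element `g₀ = (q₂)_𝔸 r₂ k r₁⁻¹ (q₁)_𝔸⁻¹` COMMUTES with `ρ_𝔸` (§3) — Milne's condition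
«`f ∘ σ(η) K = η′ K` with `f` an `𝒪_B`-isogeny» ([Milne2005ShimuraVarieties] §14 Prop. 14.12, PEL form [Kottwitz1992] §5 p. 390:
the level structures of a PEL datum are `B ⊗ 𝔸_f`-LINEAR, so their re-indexings commute with the `𝒪_B`-action).
`--supports stmt-HodgeConjecture-24832`, count-neutral; HC_CM is proved only modulo the printed citations until rung 0 closes.

* §1 `AdelicCongr.mulVec_of_intertwiner` — an INTEGRAL adelic matrix `Λ` with `B ℓ_𝔸 = Λ B` and `B′ ℓ′_𝔸 = Λ B′` transports
  `AdelicCongr B B′ v w → AdelicCongr B B′ (ℓ v) (ℓ′ w)` (`B(ℓv)^ − B′(ℓ′w)^ = Λ (B v̂ − B′ ŵ) ∈ Λ ℤ̂^{2g} ⊆ ℤ̂^{2g}`).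
* §2 `adelicCongr_mulVec_of_conj` — the kernel shape `B = k r₁⁻¹`, `B′ = r₂⁻¹`: `ℓ′_𝔸 (r₂ k r₁⁻¹) = (r₂ k r₁⁻¹) ℓ_𝔸`, `ℓ′` integral,
  `r₂ ∈ K_δ(1)` ⇒ `hℓ` (`Λ := r₂⁻¹ ℓ′_𝔸 r₂`).
* §3 `adelicCongr_mulVec_of_frame` — FRAME FORM: `ℓ = q₁⁻¹ ρ q₁`, `ℓ′ = q₂⁻¹ ρ q₂` and `g₀ ρ_𝔸 = ρ_𝔸 g₀` ⇒ `hℓ`;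
  `adelicCongr_mulVec_of_frame_intCast` — the same with `ℓ, ℓ′` the casts of integral readings `Mρ a b`, `Mρ a′ b` (integrality automatic).

## References
* [Milne2005ShimuraVarieties] J. S. Milne, *Introduction to Shimura varieties* (2005), §6 Thm. 6.11 p. 74 and p. 75, §14 Prop. 14.12 p. 125.
* [Kottwitz1992] R. Kottwitz, *Points on some Shimura varieties over finite fields*, JAMS 5 (1992), §5 p. 390.
* [Deligne1971TravauxShimura] P. Deligne, *Travaux de Shimura* (1971), 4.12 (b) pp. 148–149, 4.16 p. 150.
-/

set_option autoImplicit false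

noncomputable section

open Matrix NumberField IsDedekindDomain

namespace Literature.AlgebraicGeometry.ModuliOfAbelianVarieties

variable {g : ℕ} {δ : Fin g → ℕ}

/-! ### §0. Helpers (integrality bookkeeping, `adelicMatrix` algebra) -/

/-- Integral matrices send integral vectors to integral vectors. [folklore] -/
private theorem mulVec_apply_mem_integralAdeles_of_forall {M : Matrix (Fin g ⊕ Fin g) (Fin g ⊕ Fin g) finAdeleQ}
    (hM : ∀ i j, M i j ∈ FiniteAdeleRing.integralAdeles (𝓞 ℚ) ℚ) {y : Fin g ⊕ Fin g → finAdeleQ}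
    (hy : ∀ j, y j ∈ FiniteAdeleRing.integralAdeles (𝓞 ℚ) ℚ) (i : Fin g ⊕ Fin g) :
    (M *ᵥ y) i ∈ FiniteAdeleRing.integralAdeles (𝓞 ℚ) ℚ := by
  rw [Matrix.mulVec, dotProduct]; exact sum_mem fun j _ => mul_mem (hM i j) (hy j)

/-- Products of integral matrices are integral. [folklore] -/
private theorem mul_apply_mem_integralAdeles_of_forall {M N : Matrix (Fin g ⊕ Fin g) (Fin g ⊕ Fin g) finAdeleQ}
    (hM : ∀ i j, M i j ∈ FiniteAdeleRing.integralAdeles (𝓞 ℚ) ℚ)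
    (hN : ∀ i j, N i j ∈ FiniteAdeleRing.integralAdeles (𝓞 ℚ) ℚ) (i j : Fin g ⊕ Fin g) :
    (M * N) i j ∈ FiniteAdeleRing.integralAdeles (𝓞 ℚ) ℚ := by
  rw [Matrix.mul_apply]; exact sum_mem fun l _ => mul_mem (hM i l) (hN l j)

/-- `adelicMatrix` is multiplicative. [folklore] -/
private theorem adelicMatrix_mul' (M N : Matrix (Fin g ⊕ Fin g) (Fin g ⊕ Fin g) ℚ) :
    adelicMatrix (M * N) = adelicMatrix M * adelicMatrix N := by
  unfold adelicMatrix; rw [Matrix.map_mul]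

/-- The cast of an integral matrix has integral adelic entries. [folklore] -/
private theorem adelicMatrix_map_intCast_apply_mem (M : Matrix (Fin g ⊕ Fin g) (Fin g ⊕ Fin g) ℤ) (i j : Fin g ⊕ Fin g) :
    adelicMatrix (M.map (Int.cast : ℤ → ℚ)) i j ∈ FiniteAdeleRing.integralAdeles (𝓞 ℚ) ℚ := by
  rw [adelicMatrix_apply, Matrix.map_apply, map_intCast]; exact intCast_mem _ _

/-- The adelic image of `q ∈ GSp_δ(ℚ)` as a matrix is `adelicMatrix q` (definitional). [folklore] -/
private theorem coe_toFinAdelic' (q : gspRational δ) :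
    (((gspRationalToFinAdelic δ q : gspFinAdelic δ) : GL (Fin g ⊕ Fin g) finAdeleQ) :
        Matrix (Fin g ⊕ Fin g) (Fin g ⊕ Fin g) finAdeleQ) =
      adelicMatrix (((q : gspRational δ) : GL (Fin g ⊕ Fin g) ℚ) : Matrix (Fin g ⊕ Fin g) (Fin g ⊕ Fin g) ℚ) := rfl

/-- `adelicMatrix q⁻¹ * adelicMatrix q = 1` for `q ∈ GL_{2g}(ℚ)`. [folklore] -/
private theorem adelicMatrix_inv_mul' (x : GL (Fin g ⊕ Fin g) ℚ) :
    adelicMatrix ((x⁻¹ : GL (Fin g ⊕ Fin g) ℚ) : Matrix (Fin g ⊕ Fin g) (Fin g ⊕ Fin g) ℚ) *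
      adelicMatrix (x : Matrix (Fin g ⊕ Fin g) (Fin g ⊕ Fin g) ℚ) = 1 := by
  rw [← adelicMatrix_mul', ← Units.val_mul, inv_mul_cancel, Units.val_one]
  unfold adelicMatrix
  rw [Matrix.map_one _ (map_zero _) (map_one _)]

/-! ### §1. An integral intertwiner transports the congruence along `(ℓ, ℓ′)` -/

section Intertwiner

variable {B B' : GL (Fin g ⊕ Fin g) finAdeleQ} {v w : Fin g ⊕ Fin g → ℚ}

/-- **CONGRUENCE TRANSPORT ALONG AN INTERTWINED PAIR.**  If an INTEGRAL adelic matrix `Λ` satisfies `B·ℓ_𝔸 = Λ·B` and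
`B′·ℓ′_𝔸 = Λ·B′`, then `b v̂ ≡ b′ ŵ (mod ℤ̂^{2g})` implies `b (ℓv)^ ≡ b′ (ℓ′w)^`: indeed `B(ℓv)^ − B′(ℓ′w)^ = Λ(B v̂ − B′ ŵ)`
has integral coordinates.  This is the adelic content of «an isogeny commuting with the endomorphisms carries the level structure
`η K` to `η′ K`» ([Milne2005ShimuraVarieties] §6 Thm. 6.11 p. 75 «`V/Λ ≅ V(𝔸_f)/Λ̂`», §14 Prop. 14.12).
[cite: Milne2005ShimuraVarieties, §6 Thm. 6.11 p. 74 and p. 75; §14 Prop. 14.12 p. 125] [cite: Deligne1971TravauxShimura, 4.12 (b) pp. 148–149] -/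
theorem AdelicCongr.mulVec_of_intertwiner (Λ : Matrix (Fin g ⊕ Fin g) (Fin g ⊕ Fin g) finAdeleQ)
    (hΛ : ∀ i j, Λ i j ∈ FiniteAdeleRing.integralAdeles (𝓞 ℚ) ℚ)
    (ℓ ℓ' : Matrix (Fin g ⊕ Fin g) (Fin g ⊕ Fin g) ℚ)
    (h₁ : (B : Matrix (Fin g ⊕ Fin g) (Fin g ⊕ Fin g) finAdeleQ) * adelicMatrix ℓ =
      Λ * (B : Matrix (Fin g ⊕ Fin g) (Fin g ⊕ Fin g) finAdeleQ))
    (h₂ : (B' : Matrix (Fin g ⊕ Fin g) (Fin g ⊕ Fin g) finAdeleQ) * adelicMatrix ℓ' =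
      Λ * (B' : Matrix (Fin g ⊕ Fin g) (Fin g ⊕ Fin g) finAdeleQ))
    (h : AdelicCongr B B' v w) : AdelicCongr B B' (ℓ *ᵥ v) (ℓ' *ᵥ w) := by
  intro i
  rw [← adelicMatrix_mulVec_adelicVec, ← adelicMatrix_mulVec_adelicVec, Matrix.mulVec_mulVec, Matrix.mulVec_mulVec, h₁, h₂,
    ← Matrix.mulVec_mulVec, ← Matrix.mulVec_mulVec, ← Matrix.mulVec_sub]
  exact mulVec_apply_mem_integralAdeles_of_forall hΛ h i

end Intertwiner

/-! ### §2. The kernel shape: `B = k r₁⁻¹`, `B′ = r₂⁻¹`, `ℓ′_𝔸 (r₂ k r₁⁻¹) = (r₂ k r₁⁻¹) ℓ_𝔸` -/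

section Conj

variable {r₁ r₂ k : gspFinAdelic δ} {v w : Fin g ⊕ Fin g → ℚ}

/-- **THE `hℓ` CLAUSE OF THE E6-γ KERNEL FROM A CONJUGATION RELATION.**  For `r₂ ∈ K_δ(1)`, a rational matrix `ℓ` and an INTEGRAL
rational matrix `ℓ′` with `ℓ′_𝔸 · (r₂ k r₁⁻¹) = (r₂ k r₁⁻¹) · ℓ_𝔸` in `M_{2g}(𝔸_{ℚ,f})`, the congruence `(k r₁⁻¹) v̂ ≡ r₂⁻¹ ŵ` implies
`(k r₁⁻¹) (ℓv)^ ≡ r₂⁻¹ (ℓ′w)^` — §1 with the integral intertwiner `Λ := r₂⁻¹ ℓ′_𝔸 r₂` (`r₂, r₂⁻¹ ∈ GL_{2g}(ℤ̂)`).  This is exactly the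
hypothesis `hℓ` of ★ `SiegelAdelicMarking.conjugate_comp_conjFibreIso_eq_of_lifts_of_hom` with `(a, r) := (r₁, r₂)`.
[cite: Milne2005ShimuraVarieties, §6 Thm. 6.11 p. 74 and p. 75; §14 Prop. 14.12 p. 125] [cite: Deligne1971TravauxShimura, 4.16 p. 150] -/
theorem adelicCongr_mulVec_of_conj (hr₂ : r₂ ∈ principalLevelSubgroup δ 1)
    (ℓ ℓ' : Matrix (Fin g ⊕ Fin g) (Fin g ⊕ Fin g) ℚ)
    (hℓ' : ∀ i j, adelicMatrix ℓ' i j ∈ FiniteAdeleRing.integralAdeles (𝓞 ℚ) ℚ)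
    (hconj : adelicMatrix ℓ' * (((r₂ * k * r₁⁻¹ : gspFinAdelic δ) : GL (Fin g ⊕ Fin g) finAdeleQ) :
        Matrix (Fin g ⊕ Fin g) (Fin g ⊕ Fin g) finAdeleQ) =
      (((r₂ * k * r₁⁻¹ : gspFinAdelic δ) : GL (Fin g ⊕ Fin g) finAdeleQ) : Matrix (Fin g ⊕ Fin g) (Fin g ⊕ Fin g) finAdeleQ) *
        adelicMatrix ℓ)
    (h : AdelicCongr ((k * r₁⁻¹ : gspFinAdelic δ) : GL (Fin g ⊕ Fin g) finAdeleQ)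
      ((r₂⁻¹ : gspFinAdelic δ) : GL (Fin g ⊕ Fin g) finAdeleQ) v w) :
    AdelicCongr ((k * r₁⁻¹ : gspFinAdelic δ) : GL (Fin g ⊕ Fin g) finAdeleQ)
      ((r₂⁻¹ : gspFinAdelic δ) : GL (Fin g ⊕ Fin g) finAdeleQ) (ℓ *ᵥ v) (ℓ' *ᵥ w) := by
  -- matrices of `r₂`, `r₂⁻¹` and `T := r₂ k r₁⁻¹`
  set R : Matrix (Fin g ⊕ Fin g) (Fin g ⊕ Fin g) finAdeleQ :=
    (((r₂ : gspFinAdelic δ) : GL (Fin g ⊕ Fin g) finAdeleQ) : Matrix (Fin g ⊕ Fin g) (Fin g ⊕ Fin g) finAdeleQ) with hR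
  set R' : Matrix (Fin g ⊕ Fin g) (Fin g ⊕ Fin g) finAdeleQ :=
    (((r₂⁻¹ : gspFinAdelic δ) : GL (Fin g ⊕ Fin g) finAdeleQ) : Matrix (Fin g ⊕ Fin g) (Fin g ⊕ Fin g) finAdeleQ) with hR'
  set T : Matrix (Fin g ⊕ Fin g) (Fin g ⊕ Fin g) finAdeleQ :=
    (((r₂ * k * r₁⁻¹ : gspFinAdelic δ) : GL (Fin g ⊕ Fin g) finAdeleQ) : Matrix (Fin g ⊕ Fin g) (Fin g ⊕ Fin g) finAdeleQ) with hT
  have hRR' : R * R' = 1 := by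
    rw [hR, hR', Subgroup.coe_inv, Units.mul_inv]
  -- `k r₁⁻¹ = r₂⁻¹ T`
  have hB : (((k * r₁⁻¹ : gspFinAdelic δ) : GL (Fin g ⊕ Fin g) finAdeleQ) : Matrix (Fin g ⊕ Fin g) (Fin g ⊕ Fin g) finAdeleQ) =
      R' * T := by
    have hgrp : (k * r₁⁻¹ : gspFinAdelic δ) = r₂⁻¹ * (r₂ * k * r₁⁻¹) := by group
    rw [hgrp, hR', hT, Subgroup.coe_mul, Units.val_mul]
  -- integrality of `Λ := R' ℓ′_𝔸 R`
  have hRint : ∀ i j, R i j ∈ FiniteAdeleRing.integralAdeles (𝓞 ℚ) ℚ :=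
    isIntegral_of_isCongOne_one ((mem_principalLevelSubgroup_iff δ).1 hr₂).1
  have hR'int : ∀ i j, R' i j ∈ FiniteAdeleRing.integralAdeles (𝓞 ℚ) ℚ :=
    isIntegral_of_isCongOne_one ((mem_principalLevelSubgroup_iff δ).1 hr₂).2
  have hΛ : ∀ i j, (R' * adelicMatrix ℓ' * R) i j ∈ FiniteAdeleRing.integralAdeles (𝓞 ℚ) ℚ :=
    mul_apply_mem_integralAdeles_of_forall (mul_apply_mem_integralAdeles_of_forall hR'int hℓ') hRint
  refine AdelicCongr.mulVec_of_intertwiner (R' * adelicMatrix ℓ' * R) hΛ ℓ ℓ' ?_ ?_ h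
  · -- `B ℓ_𝔸 = R' T ℓ_𝔸 = R' ℓ′_𝔸 T = (R' ℓ′_𝔸 R)(R' T) = Λ B`
    rw [hB]
    calc R' * T * adelicMatrix ℓ = R' * (T * adelicMatrix ℓ) := Matrix.mul_assoc _ _ _
      _ = R' * (adelicMatrix ℓ' * T) := by rw [hconj]
      _ = R' * adelicMatrix ℓ' * (R * R') * T := by rw [hRR', Matrix.mul_one, Matrix.mul_assoc]
      _ = R' * adelicMatrix ℓ' * R * (R' * T) := by simp only [Matrix.mul_assoc]
  · -- `B′ ℓ′_𝔸 = R' ℓ′_𝔸 = (R' ℓ′_𝔸 R) R'`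
    change R' * adelicMatrix ℓ' = R' * adelicMatrix ℓ' * R * R'
    rw [Matrix.mul_assoc (R' * adelicMatrix ℓ') R R', hRR', Matrix.mul_one]

end Conj

/-! ### §3. The frame form: two mover-conjugates of one rational reading and an `F`-linear re-indexing -/

section Frame

variable {r₁ r₂ k : gspFinAdelic δ} {v w : Fin g ⊕ Fin g → ℚ}

/-- **THE `hℓ` CLAUSE FROM THE FRAME LAW.**  Let `ρ` be a rational matrix (the frame reading of one `b ∈ 𝒪_F`), `q₁, q₂ ∈ GSp_δ(ℚ)` (the
movers of the two representatives), `ℓ = q₁⁻¹ ρ q₁` and `ℓ′ = q₂⁻¹ ρ q₂` (the readings `Mρ a b`, `Mρ a′ b` — the (N)∕(M-fr) clause of ★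
`UnitaryCurve.AuxV.exists_chartActionReading`), `ℓ′` integral, `r₂ ∈ K_δ(1)`.  If the re-indexing element
`g₀ := (q₂)_𝔸 · r₂ k r₁⁻¹ · (q₁)_𝔸⁻¹` COMMUTES with `ρ_𝔸` (it does when it is `F ⊗ 𝔸_f`-linear and `ρ` is the `F`-action: PEL level
structures are `B ⊗ 𝔸_f`-linear, [Kottwitz1992] §5 p. 390), then the pair `(ℓ, ℓ′)` preserves the congruence `(k r₁⁻¹) v̂ ≡ r₂⁻¹ ŵ` — the
`hℓ` of ★ `SiegelAdelicMarking.conjugate_comp_conjFibreIso_eq_of_lifts_of_hom`.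
[cite: Kottwitz1992, §5 p. 390] [cite: Milne2005ShimuraVarieties, §14 Prop. 14.12 p. 125; §6 Thm. 6.11 p. 74 and p. 75] -/
theorem adelicCongr_mulVec_of_frame (hr₂ : r₂ ∈ principalLevelSubgroup δ 1) (q₁ q₂ : gspRational δ)
    (ρ ℓ ℓ' : Matrix (Fin g ⊕ Fin g) (Fin g ⊕ Fin g) ℚ)
    (hℓ : ℓ = (((q₁⁻¹ : gspRational δ) : GL (Fin g ⊕ Fin g) ℚ) : Matrix (Fin g ⊕ Fin g) (Fin g ⊕ Fin g) ℚ) * ρ *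
      (((q₁ : gspRational δ) : GL (Fin g ⊕ Fin g) ℚ) : Matrix (Fin g ⊕ Fin g) (Fin g ⊕ Fin g) ℚ))
    (hℓ'eq : ℓ' = (((q₂⁻¹ : gspRational δ) : GL (Fin g ⊕ Fin g) ℚ) : Matrix (Fin g ⊕ Fin g) (Fin g ⊕ Fin g) ℚ) * ρ *
      (((q₂ : gspRational δ) : GL (Fin g ⊕ Fin g) ℚ) : Matrix (Fin g ⊕ Fin g) (Fin g ⊕ Fin g) ℚ))
    (hℓ' : ∀ i j, adelicMatrix ℓ' i j ∈ FiniteAdeleRing.integralAdeles (𝓞 ℚ) ℚ)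
    (hlin : (((gspRationalToFinAdelic δ q₂ * (r₂ * k * r₁⁻¹) * (gspRationalToFinAdelic δ q₁)⁻¹ : gspFinAdelic δ) :
          GL (Fin g ⊕ Fin g) finAdeleQ) : Matrix (Fin g ⊕ Fin g) (Fin g ⊕ Fin g) finAdeleQ) * adelicMatrix ρ =
      adelicMatrix ρ * (((gspRationalToFinAdelic δ q₂ * (r₂ * k * r₁⁻¹) * (gspRationalToFinAdelic δ q₁)⁻¹ : gspFinAdelic δ) :
          GL (Fin g ⊕ Fin g) finAdeleQ) : Matrix (Fin g ⊕ Fin g) (Fin g ⊕ Fin g) finAdeleQ))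
    (h : AdelicCongr ((k * r₁⁻¹ : gspFinAdelic δ) : GL (Fin g ⊕ Fin g) finAdeleQ)
      ((r₂⁻¹ : gspFinAdelic δ) : GL (Fin g ⊕ Fin g) finAdeleQ) v w) :
    AdelicCongr ((k * r₁⁻¹ : gspFinAdelic δ) : GL (Fin g ⊕ Fin g) finAdeleQ)
      ((r₂⁻¹ : gspFinAdelic δ) : GL (Fin g ⊕ Fin g) finAdeleQ) (ℓ *ᵥ v) (ℓ' *ᵥ w) := by
  refine adelicCongr_mulVec_of_conj hr₂ ℓ ℓ' hℓ' ?_ h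
  -- names: `Qᵢ := (qᵢ)_𝔸`, `Qᵢ' := (qᵢ⁻¹)_𝔸`, `T := r₂ k r₁⁻¹`, `P := ρ_𝔸`
  set Q₁ : Matrix (Fin g ⊕ Fin g) (Fin g ⊕ Fin g) finAdeleQ :=
    adelicMatrix (((q₁ : gspRational δ) : GL (Fin g ⊕ Fin g) ℚ) : Matrix (Fin g ⊕ Fin g) (Fin g ⊕ Fin g) ℚ)
  set Q₁' : Matrix (Fin g ⊕ Fin g) (Fin g ⊕ Fin g) finAdeleQ :=
    adelicMatrix ((((q₁ : gspRational δ) : GL (Fin g ⊕ Fin g) ℚ)⁻¹ : GL (Fin g ⊕ Fin g) ℚ) :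
      Matrix (Fin g ⊕ Fin g) (Fin g ⊕ Fin g) ℚ)
  set Q₂ : Matrix (Fin g ⊕ Fin g) (Fin g ⊕ Fin g) finAdeleQ :=
    adelicMatrix (((q₂ : gspRational δ) : GL (Fin g ⊕ Fin g) ℚ) : Matrix (Fin g ⊕ Fin g) (Fin g ⊕ Fin g) ℚ)
  set Q₂' : Matrix (Fin g ⊕ Fin g) (Fin g ⊕ Fin g) finAdeleQ :=
    adelicMatrix ((((q₂ : gspRational δ) : GL (Fin g ⊕ Fin g) ℚ)⁻¹ : GL (Fin g ⊕ Fin g) ℚ) :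
      Matrix (Fin g ⊕ Fin g) (Fin g ⊕ Fin g) ℚ)
  set T : Matrix (Fin g ⊕ Fin g) (Fin g ⊕ Fin g) finAdeleQ :=
    (((r₂ * k * r₁⁻¹ : gspFinAdelic δ) : GL (Fin g ⊕ Fin g) finAdeleQ) : Matrix (Fin g ⊕ Fin g) (Fin g ⊕ Fin g) finAdeleQ)
  set P : Matrix (Fin g ⊕ Fin g) (Fin g ⊕ Fin g) finAdeleQ := adelicMatrix ρ
  have h11 : Q₁' * Q₁ = 1 := adelicMatrix_inv_mul' _
  have h22' : Q₂' * Q₂ = 1 := adelicMatrix_inv_mul' _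
  -- the re-indexing element as a matrix: `g₀ = Q₂ T Q₁'`
  have hg₀ : (((gspRationalToFinAdelic δ q₂ * (r₂ * k * r₁⁻¹) * (gspRationalToFinAdelic δ q₁)⁻¹ : gspFinAdelic δ) :
          GL (Fin g ⊕ Fin g) finAdeleQ) : Matrix (Fin g ⊕ Fin g) (Fin g ⊕ Fin g) finAdeleQ) = Q₂ * T * Q₁' := by
    rw [Subgroup.coe_mul, Subgroup.coe_mul, Units.val_mul, Units.val_mul, ← map_inv, coe_toFinAdelic', coe_toFinAdelic',
      Subgroup.coe_inv]
  rw [hg₀] at hlin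
  -- the two readings, adelised
  have hℓA : adelicMatrix ℓ = Q₁' * P * Q₁ := by
    rw [hℓ, adelicMatrix_mul', adelicMatrix_mul', Subgroup.coe_inv]
  have hℓ'A : adelicMatrix ℓ' = Q₂' * P * Q₂ := by
    rw [hℓ'eq, adelicMatrix_mul', adelicMatrix_mul', Subgroup.coe_inv]
  -- `ℓ′_𝔸 T = Q₂' P Q₂ T = Q₂' P (Q₂ T Q₁') Q₁ = Q₂' (Q₂ T Q₁') P Q₁ = T (Q₁' P Q₁) = T ℓ_𝔸`
  rw [hℓA, hℓ'A]
  calc Q₂' * P * Q₂ * T = Q₂' * P * (Q₂ * T * Q₁') * Q₁ := by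
        rw [show Q₂' * P * (Q₂ * T * Q₁') * Q₁ = Q₂' * P * (Q₂ * T) * (Q₁' * Q₁) by simp only [Matrix.mul_assoc], h11,
          Matrix.mul_one, Matrix.mul_assoc (Q₂' * P) Q₂ T]
    _ = Q₂' * (Q₂ * T * Q₁' * P) * Q₁ := by
        rw [Matrix.mul_assoc Q₂' P (Q₂ * T * Q₁'), ← hlin]
    _ = T * (Q₁' * P * Q₁) := by
        rw [show Q₂' * (Q₂ * T * Q₁' * P) * Q₁ = Q₂' * Q₂ * (T * (Q₁' * P * Q₁)) by simp only [Matrix.mul_assoc], h22',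
          Matrix.one_mul]

/-- **THE `hℓ` CLAUSE FROM THE FRAME LAW — integral readings.**  The same with `ℓ := (M a b)` and `ℓ′ := (M a′ b)` the casts of two
INTEGRAL readings (`Mρ a b`, `Mρ a′ b ∈ M_{2g}(ℤ)`, the E-line chart՚s `Mρ`), whose casts are the mover-conjugates `q₁⁻¹ ρ q₁`, `q₂⁻¹ ρ q₂`
of one rational frame reading `ρ`; integrality of `ℓ′` is then automatic.
[cite: Kottwitz1992, §5 p. 390] [cite: Milne2005ShimuraVarieties, §14 Prop. 14.12 p. 125; §6 Thm. 6.11 p. 74 and p. 75] -/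
theorem adelicCongr_mulVec_of_frame_intCast (hr₂ : r₂ ∈ principalLevelSubgroup δ 1) (q₁ q₂ : gspRational δ)
    (ρ : Matrix (Fin g ⊕ Fin g) (Fin g ⊕ Fin g) ℚ) (M M' : Matrix (Fin g ⊕ Fin g) (Fin g ⊕ Fin g) ℤ)
    (hM : M.map (Int.cast : ℤ → ℚ) =
      (((q₁⁻¹ : gspRational δ) : GL (Fin g ⊕ Fin g) ℚ) : Matrix (Fin g ⊕ Fin g) (Fin g ⊕ Fin g) ℚ) * ρ *
        (((q₁ : gspRational δ) : GL (Fin g ⊕ Fin g) ℚ) : Matrix (Fin g ⊕ Fin g) (Fin g ⊕ Fin g) ℚ))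
    (hM' : M'.map (Int.cast : ℤ → ℚ) =
      (((q₂⁻¹ : gspRational δ) : GL (Fin g ⊕ Fin g) ℚ) : Matrix (Fin g ⊕ Fin g) (Fin g ⊕ Fin g) ℚ) * ρ *
        (((q₂ : gspRational δ) : GL (Fin g ⊕ Fin g) ℚ) : Matrix (Fin g ⊕ Fin g) (Fin g ⊕ Fin g) ℚ))
    (hlin : (((gspRationalToFinAdelic δ q₂ * (r₂ * k * r₁⁻¹) * (gspRationalToFinAdelic δ q₁)⁻¹ : gspFinAdelic δ) :
          GL (Fin g ⊕ Fin g) finAdeleQ) : Matrix (Fin g ⊕ Fin g) (Fin g ⊕ Fin g) finAdeleQ) * adelicMatrix ρ =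
      adelicMatrix ρ * (((gspRationalToFinAdelic δ q₂ * (r₂ * k * r₁⁻¹) * (gspRationalToFinAdelic δ q₁)⁻¹ : gspFinAdelic δ) :
          GL (Fin g ⊕ Fin g) finAdeleQ) : Matrix (Fin g ⊕ Fin g) (Fin g ⊕ Fin g) finAdeleQ))
    (v w : Fin g ⊕ Fin g → ℚ)
    (h : AdelicCongr ((k * r₁⁻¹ : gspFinAdelic δ) : GL (Fin g ⊕ Fin g) finAdeleQ)
      ((r₂⁻¹ : gspFinAdelic δ) : GL (Fin g ⊕ Fin g) finAdeleQ) v w) :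
    AdelicCongr ((k * r₁⁻¹ : gspFinAdelic δ) : GL (Fin g ⊕ Fin g) finAdeleQ)
      ((r₂⁻¹ : gspFinAdelic δ) : GL (Fin g ⊕ Fin g) finAdeleQ)
      (M.map (Int.cast : ℤ → ℚ) *ᵥ v) (M'.map (Int.cast : ℤ → ℚ) *ᵥ w) :=
  adelicCongr_mulVec_of_frame hr₂ q₁ q₂ ρ _ _ hM hM' (adelicMatrix_map_intCast_apply_mem M') hlin h

end Frame

end Literature.AlgebraicGeometry.ModuliOfAbelianVarieties

end
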